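import Literature.MathematicalPhysics.QuantumLattice.LiebRobinsonProofs
import Literature.MathematicalPhysics.QuantumLattice.FinDimSpectrumSpectralGapProofs
import Literature.MathematicalPhysics.QuantumLattice.QuasiLocalAlgebraDynamicsProofs
import Mathlib.Analysis.SpecialFunctions.Exponential
import Mathlib.Analysis.Calculus.MeanValue
import HarnessLib

/-!
# Exponential clustering from the Lieb–Robinson bound, I: spectral and dynamical lemmas

Sibling proof file of `Literature/MathematicalPhysics/QuantumLattice/LiebRobinson.lean`, second of the
files discharging the named fact `hastings_koma` (Hastings–Koma CMP **265** (2006) Thm. 8 /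
Nachtergaele–Sims CMP **265** (2006) Thm. 2); the assembly is in
`LiebRobinsonHastingsKomaProofs.lean`. Theorems only. Contents (HK06 §3, proof of Thm. 8, the
displays following "In terms of the ground state vectors …", with `q = 1`; NS06 §3.2 "Using the
spectral theorem, we may write …"):

* **Spectral resolution** of a Hermitian matrix in `dotProduct` form (Mathlib's
  `Matrix.IsHermitian.eigenvectorBasis`): `exp_smul_mulVec_of_mulVec_eq` /
  `exp_smul_mulVec_eigenvectorBasis` (`e^{uH} vᵢ = e^{uλᵢ} vᵢ`), orthonormality, completeness and
  Parseval (`star_eigenvectorBasis_dotProduct`, `sum_dotProduct_smul_eigenvectorBasis`,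
  `sum_norm_sq_dotProduct_eigenvectorBasis`), and the representation `commutator_expect_eq_sum`
  `⟨ψ,[A,τ_t(B)]ψ⟩ = Σᵢ (aᵢ e^{it(λᵢ-E₀)} - bᵢ e^{-it(λᵢ-E₀)})`, `aᵢ = ⟨ψ,Avᵢ⟩⟨vᵢ,Bψ⟩`,
  `bᵢ = ⟨ψ,Bvᵢ⟩⟨vᵢ,Aψ⟩`, together with `Σᵢ aᵢ = ⟨AB⟩` (`sum_dotProduct_mulVec_mul_dotProduct`),
  the ground-state term `ground_term_eq` and the summability `Σ‖aᵢ‖ ≤ ‖A‖‖B‖`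
  (`sum_norm_weights_le`, Cauchy–Schwarz and Parseval).
* **The gap** (`exists_ground_index`): under `HasSpectralGap γ` a normalised ground-state vector is
  `c v_{i₀}`, `|c| = 1`, for the unique index `i₀` with `λ_{i₀} = E₀`, all other `λᵢ ≥ E₀ + γ`.
* **Dynamics**: the Lipschitz bound `‖τ_t(B) - τ_s(B)‖ ≤ ‖[H,B]‖|t-s|`
  (`norm_heisenbergEvolution_sub_le`, from the tree's Heisenberg equation of motion
  `hasDerivAt_heisenbergEvolution` and the mean value inequality); locality of the commutator with
  the Hamiltonian, `‖[H_Λ,B]‖ ≤ 2‖B‖ Σ_{Z∩Y≠∅} ‖Φ Z‖ ≤ 2‖B‖|Y| 2^{|box ⌊R⌋|} max(J,0)`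
  (`norm_commutator_localHamiltonian_le`, `sum_norm_restrict_filter_mem_le`,
  `norm_commutator_boxlike_le`; the finite-range count uses the tree's
  `HasFiniteRange.subset_image_box`); and the three bounds on `h(t) = ⟨ψ,[A,τ_t(B)]ψ⟩` consumed by
  the filter: Lipschitz at `0` (`norm_commutator_expect_sub_le`), trivial
  (`norm_commutator_expect_le`), Lieb–Robinson (`norm_commutator_expect_le_of_le`).

## References

* M. B. Hastings, T. Koma, CMP **265** (2006) 781–804, §3; arXiv:math-ph/0507008 p. 6.
  [HastingsKomaCMP2006]
* B. Nachtergaele, R. Sims, CMP **265** (2006) 119–130, §3.2; arXiv:math-ph/0506030 pp. 7–8.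
  [NachtergaeleSimsCMP2006]
* D. Ruelle, *Statistical Mechanics: Rigorous Results* (1969), §7.6 eq. (6.16) (the commutator
  with the Hamiltonian). [Ruelle1969]
* Mathlib: `Matrix.IsHermitian.mulVec_eigenvectorBasis`, `OrthonormalBasis.sum_repr'`,
  `OrthonormalBasis.sum_sq_norm_inner_right`, `hasDerivAt_exp_smul_const'`,
  `Convex.norm_image_sub_le_of_norm_hasDerivWithin_le`, `Matrix.l2_opNorm_mulVec`,
  `Matrix.l2_opNorm_conjTranspose`, `finrank_eq_one_iff_of_nonzero'`,
  `Real.sum_mul_le_sqrt_mul_sqrt`; the tree: `norm_heisenbergEvolution_holds`,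
  `hasDerivAt_heisenbergEvolution`, `norm_commutator_le`, `commute_of_disjoint_holds`,
  `norm_restrict_apply_le`, `restrict_apply_eq_zero`, `norm_vectorState_le`,
  `IsHermitian.hasSpectralGap_iff_card_filter`, `HasSpectralGap.hasUniqueGroundState`.
-/

noncomputable section

open Matrix Complex Finset
open scoped Matrix.Norms.L2Operator ComplexOrder InnerProductSpace

namespace Literature.MathematicalPhysics.QuantumLattice

variable {n : Type*} [Fintype n] [DecidableEq n]

/-! ### Spectral resolution of a Hermitian matrix in `dotProduct` form -/

/-- **The matrix exponential on an eigenvector**: `A v = c v ⟹ e^{uA} v = e^{uc} v`. [folklore] -/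
theorem exp_smul_mulVec_of_mulVec_eq (A : Matrix n n ℂ) {v : n → ℂ} {c : ℂ}
    (hv : A *ᵥ v = c • v) (u : ℂ) : NormedSpace.exp (u • A) *ᵥ v = Complex.exp (u * c) • v := by
  set Ψ : ℂ → (n → ℂ) := fun w => Complex.exp (-(w * c)) • (NormedSpace.exp (w • A) *ᵥ v) with hΨ
  have hΨd : ∀ w, HasDerivAt Ψ 0 w := by
    intro w
    have h1 : HasDerivAt (fun w : ℂ => Complex.exp (-(w * c))) (Complex.exp (-(w * c)) * -c) w := by
      have := ((hasDerivAt_id w).mul_const c).neg.cexp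
      simpa using this
    obtain ⟨Lv, hLv⟩ : ∃ Lv : Matrix n n ℂ →L[ℂ] (n → ℂ), ∀ M, Lv M = M *ᵥ v :=
      ⟨LinearMap.toContinuousLinearMap
        { toFun := fun M => M *ᵥ v
          map_add' := fun _ _ => Matrix.add_mulVec _ _ _
          map_smul' := fun _ _ => Matrix.smul_mulVec _ _ _ }, fun M => rfl⟩
    have h2 : HasDerivAt (fun w : ℂ => NormedSpace.exp (w • A) *ᵥ v)
        ((A * NormedSpace.exp (w • A)) *ᵥ v) w := by
      have h := Lv.hasFDerivAt.comp_hasDerivAt w (hasDerivAt_exp_smul_const' (𝕂 := ℂ) A w)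
      simp only [Function.comp_def, hLv] at h
      exact h
    have h := h1.smul h2
    have hcomm : A * NormedSpace.exp (w • A) = NormedSpace.exp (w • A) * A :=
      (((Commute.refl A).smul_left w).exp_left).eq.symm
    have key : Complex.exp (-(w * c)) • ((A * NormedSpace.exp (w • A)) *ᵥ v) +
        (Complex.exp (-(w * c)) * -c) • (NormedSpace.exp (w • A) *ᵥ v) = 0 := by
      rw [hcomm, ← Matrix.mulVec_mulVec, hv, Matrix.mulVec_smul, smul_smul, ← add_smul]
      ring_nf
      simp
    rw [key] at h
    exact h
  have hconst : Ψ u = Ψ 0 :=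
    is_const_of_deriv_eq_zero (fun w => (hΨd w).differentiableAt) (fun w => (hΨd w).deriv) u 0
  have h0 : Ψ 0 = v := by simp [hΨ]
  have h1 : Ψ u = Complex.exp (-(u * c)) • (NormedSpace.exp (u • A) *ᵥ v) := by simp [hΨ]
  rw [h0, h1] at hconst
  have := congrArg (fun z => Complex.exp (u * c) • z) hconst
  simp only [smul_smul, ← Complex.exp_add, add_neg_cancel, Complex.exp_zero, one_smul] at this
  exact this

/-- Orthonormality of the eigenvector basis in `dotProduct` form. [folklore] -/
theorem star_eigenvectorBasis_dotProduct {H : Matrix n n ℂ} (hH : H.IsHermitian) (i j : n) :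
    star (⇑(hH.eigenvectorBasis i)) ⬝ᵥ ⇑(hH.eigenvectorBasis j) = if i = j then 1 else 0 := by
  have h := orthonormal_iff_ite.mp hH.eigenvectorBasis.orthonormal i j
  rw [EuclideanSpace.inner_eq_star_dotProduct, dotProduct_comm] at h
  exact h

/-- Completeness of the eigenvector basis in `dotProduct` form: `w = Σᵢ (vᵢ⋆ · w) vᵢ`. [folklore] -/
theorem sum_dotProduct_smul_eigenvectorBasis {H : Matrix n n ℂ} (hH : H.IsHermitian) (w : n → ℂ) :
    ∑ i, (star (⇑(hH.eigenvectorBasis i)) ⬝ᵥ w) • ⇑(hH.eigenvectorBasis i) = w := by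
  have h := hH.eigenvectorBasis.sum_repr' (WithLp.toLp 2 w)
  have h' := congrArg WithLp.ofLp h
  simp only [WithLp.ofLp_sum, WithLp.ofLp_smul] at h'
  convert h' using 2 with i
  rw [EuclideanSpace.inner_eq_star_dotProduct, dotProduct_comm]

/-- Parseval for the eigenvector basis in `dotProduct` form. [folklore] -/
theorem sum_norm_sq_dotProduct_eigenvectorBasis {H : Matrix n n ℂ} (hH : H.IsHermitian) (w : n → ℂ) :
    ∑ i, ‖star (⇑(hH.eigenvectorBasis i)) ⬝ᵥ w‖ ^ 2 = ‖WithLp.toLp 2 w‖ ^ 2 := by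
  rw [← hH.eigenvectorBasis.sum_sq_norm_inner_right (WithLp.toLp 2 w)]
  refine Finset.sum_congr rfl fun i _ => ?_
  rw [EuclideanSpace.inner_eq_star_dotProduct, dotProduct_comm]

/-- Time evolution of an eigenvector. [folklore] -/
theorem exp_smul_mulVec_eigenvectorBasis {H : Matrix n n ℂ} (hH : H.IsHermitian) (u : ℂ) (i : n) :
    NormedSpace.exp (u • H) *ᵥ ⇑(hH.eigenvectorBasis i) =
      Complex.exp (u * hH.eigenvalues i) • ⇑(hH.eigenvectorBasis i) :=
  exp_smul_mulVec_of_mulVec_eq H (by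
    rw [hH.mulVec_eigenvectorBasis i]
    funext k
    simp only [Pi.smul_apply, Complex.real_smul, smul_eq_mul]) u

/-- Spectral expansion of a matrix element of `M e^{uH}`:
`ψ⋆ · M e^{uH} w = Σᵢ e^{uλᵢ} (vᵢ⋆ · w) (ψ⋆ · M vᵢ)`. [folklore] -/
theorem dotProduct_mulVec_exp_mulVec {H : Matrix n n ℂ} (hH : H.IsHermitian) (M : Matrix n n ℂ) (ψ w : n → ℂ) (u : ℂ) :
    star ψ ⬝ᵥ (M *ᵥ (NormedSpace.exp (u • H) *ᵥ w)) =
      ∑ i, Complex.exp (u * hH.eigenvalues i) * (star (⇑(hH.eigenvectorBasis i)) ⬝ᵥ w) *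
        (star ψ ⬝ᵥ (M *ᵥ ⇑(hH.eigenvectorBasis i))) := by
  conv_lhs => rw [← sum_dotProduct_smul_eigenvectorBasis hH w]
  rw [Matrix.mulVec_sum, Matrix.mulVec_sum, dotProduct_sum]
  refine Finset.sum_congr rfl fun i _ => ?_
  rw [Matrix.mulVec_smul, exp_smul_mulVec_eigenvectorBasis hH u i, smul_smul, Matrix.mulVec_smul,
    dotProduct_smul, smul_eq_mul]
  ring


/-- `(e^{itH})ᴴ = e^{-itH}` for Hermitian `H` and real `t`. [folklore] -/
theorem conjTranspose_exp_I_mul_smul {H : Matrix n n ℂ} (hH : H.IsHermitian) (t : ℝ) :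
    (NormedSpace.exp ((I * (t : ℂ)) • H))ᴴ = NormedSpace.exp ((-(I * (t : ℂ))) • H) := by
  rw [← Matrix.exp_conjTranspose, conjTranspose_smul, hH.eq]
  congr 2
  simp

/-- **Spectral representation of the commutator expectation** `h(t) = ⟨ψ, [A, τ_t(B)] ψ⟩` in a vector
`ψ` with `Hψ = E₀ψ`:
`h(t) = Σᵢ (⟨ψ,Avᵢ⟩⟨vᵢ,Bψ⟩ e^{it(λᵢ-E₀)} - ⟨ψ,Bvᵢ⟩⟨vᵢ,Aψ⟩ e^{-it(λᵢ-E₀)})`.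
HK06 §3, the displays following "In terms of the ground state vectors …" (with `q = 1`);
NS06 §3.2 ("Using the spectral theorem, we may write …"). [cite: HastingsKomaCMP2006, §3] -/
theorem commutator_expect_eq_sum {H : Matrix n n ℂ} (hH : H.IsHermitian) (A B : Matrix n n ℂ) {ψ : n → ℂ} {E₀ : ℝ}
    (hψ : H *ᵥ ψ = (E₀ : ℂ) • ψ) (t : ℝ) :
    star ψ ⬝ᵥ ((A * heisenbergEvolution H t B - heisenbergEvolution H t B * A) *ᵥ ψ) =
      ∑ i, ((star ψ ⬝ᵥ (A *ᵥ ⇑(hH.eigenvectorBasis i))) *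
              (star (⇑(hH.eigenvectorBasis i)) ⬝ᵥ (B *ᵥ ψ)) *
              cexp (((t * (hH.eigenvalues i - E₀) : ℝ) : ℂ) * I) -
            (star ψ ⬝ᵥ (B *ᵥ ⇑(hH.eigenvectorBasis i))) *
              (star (⇑(hH.eigenvectorBasis i)) ⬝ᵥ (A *ᵥ ψ)) *
              cexp (-((t * (hH.eigenvalues i - E₀) : ℝ) : ℂ) * I)) := by
  set U := NormedSpace.exp ((I * (t : ℂ)) • H) with hU
  set V := NormedSpace.exp ((-(I * (t : ℂ))) • H) with hV
  have hVψ : V *ᵥ ψ = cexp (-(I * t) * E₀) • ψ := exp_smul_mulVec_of_mulVec_eq H hψ _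
  have hUH : Uᴴ = V := conjTranspose_exp_I_mul_smul hH t
  -- first term
  have h1 : star ψ ⬝ᵥ (A *ᵥ (U *ᵥ (B *ᵥ (V *ᵥ ψ)))) =
      ∑ i, (star ψ ⬝ᵥ (A *ᵥ ⇑(hH.eigenvectorBasis i))) *
        (star (⇑(hH.eigenvectorBasis i)) ⬝ᵥ (B *ᵥ ψ)) *
        cexp (((t * (hH.eigenvalues i - E₀) : ℝ) : ℂ) * I) := by
    rw [hVψ, mulVec_smul, mulVec_smul, mulVec_smul, dotProduct_smul, smul_eq_mul, hU,
      dotProduct_mulVec_exp_mulVec hH A ψ (B *ᵥ ψ) (I * t), Finset.mul_sum]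
    refine Finset.sum_congr rfl fun i _ => ?_
    rw [show cexp (-(I * ↑t) * ↑E₀) * (cexp (I * ↑t * ↑(hH.eigenvalues i)) *
        (star ⇑(hH.eigenvectorBasis i) ⬝ᵥ B *ᵥ ψ) * (star ψ ⬝ᵥ A *ᵥ ⇑(hH.eigenvectorBasis i))) =
        (star ψ ⬝ᵥ A *ᵥ ⇑(hH.eigenvectorBasis i)) * (star ⇑(hH.eigenvectorBasis i) ⬝ᵥ B *ᵥ ψ) *
        (cexp (-(I * ↑t) * ↑E₀) * cexp (I * ↑t * ↑(hH.eigenvalues i))) by ring,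
      ← Complex.exp_add]
    congr 2
    push_cast
    ring
  -- second term
  have h2 : star ψ ⬝ᵥ (U *ᵥ (B *ᵥ (V *ᵥ (A *ᵥ ψ)))) =
      ∑ i, (star ψ ⬝ᵥ (B *ᵥ ⇑(hH.eigenvectorBasis i))) *
        (star (⇑(hH.eigenvectorBasis i)) ⬝ᵥ (A *ᵥ ψ)) *
        cexp (-((t * (hH.eigenvalues i - E₀) : ℝ) : ℂ) * I) := by
    rw [dotProduct_mulVec, ← conjTranspose_conjTranspose U, ← star_mulVec, hUH, hVψ, star_smul,
      smul_dotProduct, smul_eq_mul, hV, dotProduct_mulVec_exp_mulVec hH B ψ (A *ᵥ ψ) (-(I * t)),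
      Finset.mul_sum]
    refine Finset.sum_congr rfl fun i _ => ?_
    have hstar : star (cexp (-(I * ↑t) * ↑E₀)) = cexp (I * ↑t * ↑E₀) := by
      rw [Complex.star_def, ← Complex.exp_conj]
      congr 1
      simp [Complex.conj_ofReal]
    rw [hstar, show cexp (I * ↑t * ↑E₀) * (cexp (-(I * ↑t) * ↑(hH.eigenvalues i)) *
        (star ⇑(hH.eigenvectorBasis i) ⬝ᵥ A *ᵥ ψ) * (star ψ ⬝ᵥ B *ᵥ ⇑(hH.eigenvectorBasis i))) =
        (star ψ ⬝ᵥ B *ᵥ ⇑(hH.eigenvectorBasis i)) * (star ⇑(hH.eigenvectorBasis i) ⬝ᵥ A *ᵥ ψ) *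
        (cexp (I * ↑t * ↑E₀) * cexp (-(I * ↑t) * ↑(hH.eigenvalues i))) by ring,
      ← Complex.exp_add]
    congr 2
    push_cast
    ring
  rw [heisenbergEvolution, ← hU, ← hV, sub_mulVec, dotProduct_sub]
  simp only [← mulVec_mulVec]
  rw [h1, h2, ← Finset.sum_sub_distrib]

/-- The equal-time value: `Σᵢ ⟨ψ,Avᵢ⟩⟨vᵢ,w⟩ = ⟨ψ, A w⟩` (completeness). [folklore] -/
theorem sum_dotProduct_mulVec_mul_dotProduct {H : Matrix n n ℂ} (hH : H.IsHermitian)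
    (A : Matrix n n ℂ) (ψ w : n → ℂ) :
    ∑ i, (star ψ ⬝ᵥ (A *ᵥ ⇑(hH.eigenvectorBasis i))) *
        (star (⇑(hH.eigenvectorBasis i)) ⬝ᵥ w) = star ψ ⬝ᵥ (A *ᵥ w) := by
  have h := dotProduct_mulVec_exp_mulVec hH A ψ w 0
  rw [zero_smul, NormedSpace.exp_zero, one_mulVec] at h
  rw [h]
  refine Finset.sum_congr rfl fun i _ => ?_
  rw [zero_mul, Complex.exp_zero, one_mul, mul_comm]

omit [DecidableEq n] in
/-- The ground-state term of the spectral sums: if `ψ = c v₀` with `|c| = 1` then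
`⟨ψ,Av₀⟩⟨v₀,Bψ⟩ = ⟨ψ,Aψ⟩⟨ψ,Bψ⟩`. [folklore] -/
theorem ground_term_eq (A B : Matrix n n ℂ) {ψ v₀ : n → ℂ} {c : ℂ} (hψ : ψ = c • v₀)
    (hc : starRingEnd ℂ c * c = 1) :
    (star ψ ⬝ᵥ (A *ᵥ v₀)) * (star v₀ ⬝ᵥ (B *ᵥ ψ)) =
      (star ψ ⬝ᵥ (A *ᵥ ψ)) * (star ψ ⬝ᵥ (B *ᵥ ψ)) := by
  have hv : v₀ = starRingEnd ℂ c • ψ := by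
    rw [hψ, smul_smul, hc, one_smul]
  conv_lhs => rw [hv]
  rw [mulVec_smul, dotProduct_smul, star_smul, smul_dotProduct, smul_eq_mul, smul_eq_mul]
  have hsc : star (starRingEnd ℂ c) = c := by simp
  rw [hsc]
  calc starRingEnd ℂ c * (star ψ ⬝ᵥ A *ᵥ ψ) * (c * (star ψ ⬝ᵥ B *ᵥ ψ))
      = (starRingEnd ℂ c * c) * ((star ψ ⬝ᵥ A *ᵥ ψ) * (star ψ ⬝ᵥ B *ᵥ ψ)) := by ring
    _ = _ := by rw [hc, one_mul]

omit [DecidableEq n] in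
/-- `‖⟨ψ, A vᵢ⟩‖ = ‖⟨vᵢ, Aᴴ ψ⟩‖`. [folklore] -/
theorem norm_dotProduct_mulVec_eq (A : Matrix n n ℂ) (ψ v : n → ℂ) :
    ‖star ψ ⬝ᵥ (A *ᵥ v)‖ = ‖star v ⬝ᵥ (Aᴴ *ᵥ ψ)‖ := by
  rw [dotProduct_mulVec, ← conjTranspose_conjTranspose A, ← star_mulVec, conjTranspose_conjTranspose,
    star_dotProduct, norm_star]

omit [DecidableEq n] in
/-- The Euclidean norm of a normalised vector is `1`. [folklore] -/
theorem norm_toLp_eq_one_of_dotProduct {ψ : n → ℂ} (hψ1 : star ψ ⬝ᵥ ψ = 1) :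
    ‖(WithLp.toLp 2 ψ : EuclideanSpace ℂ n)‖ = 1 := by
  have h : ‖(WithLp.toLp 2 ψ : EuclideanSpace ℂ n)‖ ^ 2 = 1 := by
    rw [@norm_sq_eq_re_inner ℂ, EuclideanSpace.inner_toLp_toLp, dotProduct_comm, hψ1]
    simp
  have h0 : 0 ≤ ‖(WithLp.toLp 2 ψ : EuclideanSpace ℂ n)‖ := norm_nonneg _
  nlinarith

/-- **The weights are summable against the operator norms**:
`Σᵢ ‖⟨ψ,Avᵢ⟩⟨vᵢ,Bψ⟩‖ ≤ ‖A‖ ‖B‖` for a unit vector `ψ` (Cauchy–Schwarz and Parseval in the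
eigenbasis, `‖Aᴴψ‖ ≤ ‖A‖`, `‖Bψ‖ ≤ ‖B‖`). NS06 §3.2 (the estimate of `c(A,B)`). [folklore] -/
theorem sum_norm_weights_le {H : Matrix n n ℂ} (hH : H.IsHermitian) (A B : Matrix n n ℂ)
    {ψ : n → ℂ} (hψ1 : star ψ ⬝ᵥ ψ = 1) :
    ∑ i, ‖(star ψ ⬝ᵥ (A *ᵥ ⇑(hH.eigenvectorBasis i))) *
        (star (⇑(hH.eigenvectorBasis i)) ⬝ᵥ (B *ᵥ ψ))‖ ≤ ‖A‖ * ‖B‖ := by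
  set x : n → ℂ := Aᴴ *ᵥ ψ with hx
  set y : n → ℂ := B *ᵥ ψ with hy
  have hnψ := norm_toLp_eq_one_of_dotProduct hψ1
  have hxn : ‖(WithLp.toLp 2 x : EuclideanSpace ℂ n)‖ ≤ ‖A‖ := by
    have h := Matrix.l2_opNorm_mulVec Aᴴ (WithLp.toLp 2 ψ : EuclideanSpace ℂ n)
    rw [Matrix.l2_opNorm_conjTranspose, hnψ, mul_one] at h
    exact h
  have hyn : ‖(WithLp.toLp 2 y : EuclideanSpace ℂ n)‖ ≤ ‖B‖ := by
    have h := Matrix.l2_opNorm_mulVec B (WithLp.toLp 2 ψ : EuclideanSpace ℂ n)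
    rw [hnψ, mul_one] at h
    exact h
  calc ∑ i, ‖(star ψ ⬝ᵥ (A *ᵥ ⇑(hH.eigenvectorBasis i))) *
          (star (⇑(hH.eigenvectorBasis i)) ⬝ᵥ (B *ᵥ ψ))‖
      = ∑ i, ‖star (⇑(hH.eigenvectorBasis i)) ⬝ᵥ x‖ * ‖star (⇑(hH.eigenvectorBasis i)) ⬝ᵥ y‖ := by
        refine Finset.sum_congr rfl fun i _ => ?_
        rw [norm_mul, norm_dotProduct_mulVec_eq]
    _ ≤ √(∑ i, ‖star (⇑(hH.eigenvectorBasis i)) ⬝ᵥ x‖ ^ 2) *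
          √(∑ i, ‖star (⇑(hH.eigenvectorBasis i)) ⬝ᵥ y‖ ^ 2) :=
        Real.sum_mul_le_sqrt_mul_sqrt _ _ _
    _ = ‖(WithLp.toLp 2 x : EuclideanSpace ℂ n)‖ * ‖(WithLp.toLp 2 y : EuclideanSpace ℂ n)‖ := by
        rw [sum_norm_sq_dotProduct_eigenvectorBasis hH x, sum_norm_sq_dotProduct_eigenvectorBasis hH y,
          Real.sqrt_sq (norm_nonneg _), Real.sqrt_sq (norm_nonneg _)]
    _ ≤ ‖A‖ * ‖B‖ := mul_le_mul hxn hyn (norm_nonneg _) (norm_nonneg _)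

/-! ### The gapped ground state -/

/-- **The gapped ground state along the eigenbasis.** If `H` has a unique gapped ground state
(`HasSpectralGap γ`) and `ψ` is a normalised ground-state vector, then there is a unique index `i₀`
of the eigenbasis carrying the ground energy, all other eigenvalues are `≥ E₀ + γ`, and
`ψ = c v_{i₀}` with `|c| = 1`. HK06 §3 (the expansion `Φ = Σ a_ν Φ_{0,ν}` with `q = 1`);
Tasaki (2020) §2.1. [folklore] -/
theorem exists_ground_index {H : Matrix n n ℂ} (hH : H.IsHermitian) {γ : ℝ}
    (hgap : H.HasSpectralGap γ) {ψ : n → ℂ} (hψ : H.IsGroundStateVector ψ)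
    (hψ1 : star ψ ⬝ᵥ ψ = 1) :
    ∃ (i₀ : n) (c : ℂ), hH.eigenvalues i₀ = H.groundEnergy ∧
      (∀ i, i ≠ i₀ → H.groundEnergy + γ ≤ hH.eigenvalues i) ∧
      ψ = c • ⇑(hH.eigenvectorBasis i₀) ∧ starRingEnd ℂ c * c = 1 := by
  obtain ⟨-, hcard, hrange⟩ := (hH.hasSpectralGap_iff_card_filter γ).1 hgap
  obtain ⟨i₀, hi₀⟩ := Finset.card_eq_one.1 hcard
  have hmem : ∀ i, i ∈ (Finset.univ.filter fun i => hH.eigenvalues i = H.groundEnergy) ↔ i = i₀ := by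
    intro i; rw [hi₀, Finset.mem_singleton]
  have hev0 : hH.eigenvalues i₀ = H.groundEnergy := by
    have := (hmem i₀).2 rfl
    exact (Finset.mem_filter.1 this).2
  have hothers : ∀ i, i ≠ i₀ → H.groundEnergy + γ ≤ hH.eigenvalues i := by
    intro i hi
    rcases hrange ⟨i, rfl⟩ with h | h
    · exact absurd ((hmem i).1 (Finset.mem_filter.2 ⟨Finset.mem_univ _, h⟩)) hi
    · exact h
  -- the ground space is one-dimensional and contains both `ψ` and `v₀`
  set v₀ : n → ℂ := ⇑(hH.eigenvectorBasis i₀) with hv₀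
  have hv₀mem : v₀ ∈ H.groundSpace := by
    rw [Matrix.mem_groundSpace_iff, hv₀, hH.mulVec_eigenvectorBasis i₀, hev0]
    funext k
    simp only [Pi.smul_apply, Complex.real_smul, smul_eq_mul]
  have hv₀ne : v₀ ≠ 0 := by
    intro h0
    have h1 := star_eigenvectorBasis_dotProduct hH i₀ i₀
    rw [if_pos rfl, ← hv₀, h0, dotProduct_zero] at h1
    exact zero_ne_one h1
  have hψmem : ψ ∈ H.groundSpace := ((Matrix.isGroundStateVector_iff H ψ).1 hψ).2
  have h1 : Module.finrank ℂ H.groundSpace = 1 := hgap.hasUniqueGroundState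
  obtain ⟨c, hc⟩ := (finrank_eq_one_iff_of_nonzero' (⟨v₀, hv₀mem⟩ : H.groundSpace)
    (fun h => hv₀ne (congrArg Subtype.val h))).1 h1 ⟨ψ, hψmem⟩
  have hψc : ψ = c • v₀ := by
    have := congrArg Subtype.val hc
    simpa using this.symm
  refine ⟨i₀, c, hev0, hothers, hψc, ?_⟩
  have h2 := hψ1
  rw [hψc, star_smul, smul_dotProduct, dotProduct_smul, star_eigenvectorBasis_dotProduct hH i₀ i₀,
    if_pos rfl] at h2
  simpa [smul_eq_mul] using h2

/-! ### Dynamics: equation of motion, Lipschitz bound, locality of the commutator -/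

/-- **Lipschitz continuity of the Heisenberg evolution**: `‖τ_t(B) - τ_s(B)‖ ≤ ‖[H, B]‖ |t - s|`
(mean value inequality with `‖τ_u(i[H,B])‖ = ‖[H,B]‖`). Ruelle (1969) eq. (6.16) / NS06 §3.1.
[folklore] -/
theorem norm_heisenbergEvolution_sub_le {H : Matrix n n ℂ} (hH : H.IsHermitian) (B : Matrix n n ℂ)
    (s t : ℝ) :
    ‖heisenbergEvolution H t B - heisenbergEvolution H s B‖ ≤ ‖H * B - B * H‖ * |t - s| := by
  -- the derivative `e^{tK} [K, B] e^{t(-K)}` (`K = iH`) of the tree is `τ_t(i[H, B])`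
  have hder : ∀ u : ℝ, HasDerivAt (fun u : ℝ => heisenbergEvolution H u B)
      (heisenbergEvolution H u (I • (H * B - B * H))) u := by
    intro u
    refine (hasDerivAt_heisenbergEvolution H B u).congr_deriv ?_
    rw [heisenbergEvolution_eq_exp_smul, smul_sub, smul_mul_assoc, mul_smul_comm]
  have h := Convex.norm_image_sub_le_of_norm_hasDerivWithin_le
    (f := fun u : ℝ => heisenbergEvolution H u B)
    (f' := fun u : ℝ => heisenbergEvolution H u (I • (H * B - B * H))) (s := Set.univ)
    (C := ‖H * B - B * H‖) (fun u _ => (hder u).hasDerivWithinAt)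
    (fun u _ => by
      rw [norm_heisenbergEvolution_holds hH u, norm_smul, Complex.norm_I, one_mul])
    convex_univ (Set.mem_univ s) (Set.mem_univ t)
  rwa [Real.norm_eq_abs] at h

section Local

variable {Λ : Type*} [Fintype Λ] [DecidableEq Λ] {q : ℕ}

/-- **The commutator of a local observable with the Hamiltonian**: only the interaction terms meeting
the support contribute, `‖[H_Λ, B]‖ ≤ 2‖B‖ Σ_{Z ∩ Y ≠ ∅} ‖Φ Z‖` for `B ∈ 𝔄_Y` (locality). Ruelle
(1969) eq. (6.16); NS06 §3.1. [folklore] -/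
theorem norm_commutator_localHamiltonian_le {Φ : Interaction Λ q} (hΦ : Φ.IsLocal) {B : Op Λ q}
    {Y : Finset Λ} (hB : IsSupportedOn B Y) :
    ‖localHamiltonian Φ univ * B - B * localHamiltonian Φ univ‖ ≤
      2 * ‖B‖ * ∑ Z ∈ univ.filter (fun Z : Finset Λ => ¬ Disjoint Z Y), ‖Φ Z‖ := by
  have hsum : localHamiltonian Φ univ * B - B * localHamiltonian Φ univ =
      ∑ Z ∈ univ.filter (fun Z : Finset Λ => ¬ Disjoint Z Y), (Φ Z * B - B * Φ Z) := by
    rw [localHamiltonian, Finset.powerset_univ, Finset.sum_mul, Finset.mul_sum,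
      ← Finset.sum_sub_distrib, Finset.sum_filter_of_ne]
    intro Z _ hZ hd
    exact hZ (sub_eq_zero.2 (commute_of_disjoint_holds (hΦ.isSupportedOn Z) hB (by simpa using hd)).eq)
  rw [hsum]
  refine (norm_sum_le _ _).trans ?_
  rw [Finset.mul_sum]
  refine Finset.sum_le_sum fun Z _ => ?_
  calc ‖Φ Z * B - B * Φ Z‖ ≤ ‖Φ Z * B‖ + ‖B * Φ Z‖ := norm_sub_le _ _
    _ ≤ ‖Φ Z‖ * ‖B‖ + ‖B‖ * ‖Φ Z‖ := add_le_add (norm_mul_le _ _) (norm_mul_le _ _)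
    _ = 2 * ‖B‖ * ‖Φ Z‖ := by ring

/-- Summing a nonnegative function over the regions meeting `Y` is dominated by summing, over the
points `y ∈ Y`, over the regions containing `y`. [folklore] -/
theorem sum_filter_not_disjoint_le_sum_sum {g : Finset Λ → ℝ} (hg : ∀ Z, 0 ≤ g Z) (Y : Finset Λ) :
    ∑ Z ∈ univ.filter (fun Z : Finset Λ => ¬ Disjoint Z Y), g Z ≤
      ∑ y ∈ Y, ∑ Z ∈ univ.filter (fun Z : Finset Λ => y ∈ Z), g Z := by
  have hinner : ∀ y, ∑ Z ∈ univ.filter (fun Z : Finset Λ => y ∈ Z), g Z =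
      ∑ Z, if y ∈ Z then g Z else 0 := fun y => Finset.sum_filter _ _
  rw [Finset.sum_filter]
  simp only [hinner]
  rw [Finset.sum_comm]
  refine Finset.sum_le_sum fun Z _ => ?_
  by_cases hZ : Disjoint Z Y
  · rw [if_neg (not_not.2 hZ)]
    exact Finset.sum_nonneg fun y _ => by
      by_cases hy : y ∈ Z
      · rw [if_pos hy]; exact hg Z
      · rw [if_neg hy]
  · rw [if_pos hZ]
    obtain ⟨y, hyZ, hyY⟩ := Finset.not_disjoint_iff.1 hZ
    calc g Z = if y ∈ Z then g Z else 0 := by rw [if_pos hyZ]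
      _ ≤ ∑ y ∈ Y, if y ∈ Z then g Z else 0 :=
          Finset.single_le_sum (f := fun y => if y ∈ Z then g Z else 0)
            (fun y _ => by
              by_cases hy : y ∈ Z
              · rw [if_pos hy]; exact hg Z
              · rw [if_neg hy]) hyY

end Local

section Lattice

open Literature.Probability.LatticeModels Literature.Computability.QuantumComplexity

variable {d q : ℕ}

/-- **Finite range, counted**: for an interaction of range `R` with `‖Φ X‖ ≤ J`, the terms of the
finite-volume restriction containing a given site have total norm `≤ 2^{|box ⌊R⌋|} max(J, 0)` (they
are indexed by subsets of the ball of radius `⌊R⌋`). Ruelle (1969) §7.6 (proof of Lemma 7.6.1);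
NS06 §2 (`‖Φ‖_λ < ∞` for finite range). [folklore] -/
theorem sum_norm_restrict_filter_mem_le [NeZero q] {Φ : LatticeInteraction d q} {R J : ℝ}
    (hR : Φ.HasFiniteRange R) (hJ : Φ.IsBounded J) (Λ : Finset (Site d)) (y : ↥Λ) :
    ∑ Z ∈ univ.filter (fun Z : Finset ↥Λ => y ∈ Z), ‖Φ.restrict Λ Z‖ ≤
      2 ^ #(box d ⌊R⌋₊) * max J 0 := by
  set S : Finset (Finset ↥Λ) := univ.filter (fun Z : Finset ↥Λ => y ∈ Z ∧ Φ.restrict Λ Z ≠ 0)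
    with hS
  have h1 : ∑ Z ∈ S, ‖Φ.restrict Λ Z‖ =
      ∑ Z ∈ univ.filter (fun Z : Finset ↥Λ => y ∈ Z), ‖Φ.restrict Λ Z‖ := by
    rw [hS, ← Finset.filter_filter]
    exact Finset.sum_filter_of_ne fun Z _ hZ h0 => hZ (by rw [h0, norm_zero])
  have h2 : ∑ Z ∈ S, ‖Φ.restrict Λ Z‖ ≤ ∑ Z ∈ S, max J 0 := by
    refine Finset.sum_le_sum fun Z _ => ?_
    exact (norm_restrict_apply_le hJ Λ Z).trans (le_max_left _ _)
  have h3 : #S ≤ 2 ^ #(box d ⌊R⌋₊) := by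
    set T : Finset (Finset (Site d)) := (((box d ⌊R⌋₊).image fun w => (y : Site d) + w)).powerset
      with hT
    have hmaps : ∀ Z ∈ S, Z.map (Function.Embedding.subtype _) ∈ T := by
      intro Z hZ
      rw [hS, Finset.mem_filter] at hZ
      obtain ⟨-, hyZ, hZ0⟩ := hZ
      rw [hT, Finset.mem_powerset]
      refine hR.subset_image_box (fun h0 => hZ0 (restrict_apply_eq_zero Λ Z h0)) ?_
      exact Finset.mem_map.2 ⟨y, hyZ, rfl⟩
    have hinj : Set.InjOn (fun Z : Finset ↥Λ => Z.map (Function.Embedding.subtype _)) S :=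
      fun Z₁ _ Z₂ _ h => Finset.map_injective _ h
    calc #S ≤ #T := Finset.card_le_card_of_injOn _ hmaps hinj
      _ = 2 ^ #((box d ⌊R⌋₊).image fun w => (y : Site d) + w) := by rw [hT, Finset.card_powerset]
      _ ≤ 2 ^ #(box d ⌊R⌋₊) := Nat.pow_le_pow_right (by norm_num) Finset.card_image_le
  rw [← h1]
  refine h2.trans ?_
  rw [Finset.sum_const, nsmul_eq_mul]
  refine mul_le_mul_of_nonneg_right ?_ (le_max_right _ _)
  exact_mod_cast h3

/-- **The Lipschitz constant of the commutator function, uniformly in the volume**: for `B ∈ 𝔄_Y`,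
`‖[H_Λ, B]‖ ≤ 2‖B‖ |Y| 2^{|box ⌊R⌋|} max(J,0)`. [folklore] -/
theorem norm_commutator_boxlike_le [NeZero q] {Φ : LatticeInteraction d q} {R J : ℝ}
    (hH : Φ.IsHermitian) (hR : Φ.HasFiniteRange R) (hJ : Φ.IsBounded J) (Λ : Finset (Site d))
    {B : Op ↥Λ q} {Y : Finset ↥Λ} (hB : IsSupportedOn B Y) :
    ‖localHamiltonian (Φ.restrict Λ) univ * B - B * localHamiltonian (Φ.restrict Λ) univ‖ ≤
      2 * ‖B‖ * (#Y * (2 ^ #(box d ⌊R⌋₊) * max J 0)) := by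
  refine (norm_commutator_localHamiltonian_le (hH.isLocal_restrict Λ) hB).trans ?_
  refine mul_le_mul_of_nonneg_left ?_ (by positivity)
  refine (sum_filter_not_disjoint_le_sum_sum (fun Z => norm_nonneg _) Y).trans ?_
  calc ∑ y ∈ Y, ∑ Z ∈ univ.filter (fun Z : Finset ↥Λ => y ∈ Z), ‖Φ.restrict Λ Z‖
      ≤ ∑ y ∈ Y, 2 ^ #(box d ⌊R⌋₊) * max J 0 :=
        Finset.sum_le_sum fun y _ => sum_norm_restrict_filter_mem_le hR hJ Λ y
    _ = #Y * (2 ^ #(box d ⌊R⌋₊) * max J 0) := by rw [Finset.sum_const, nsmul_eq_mul]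

end Lattice


/-! ### Bounds on the commutator expectation `h(t) = ⟨ψ, [A, τ_t(B)] ψ⟩` -/

/-- **Lipschitz bound at the origin**: `‖h(t) - h(-t)‖ ≤ 4‖A‖ Q t` whenever `‖[H, B]‖ ≤ Q`
(`h(t) - h(-t) = ⟨ψ, [A, τ_t(B) - τ_{-t}(B)] ψ⟩` and `‖τ_t(B) - τ_{-t}(B)‖ ≤ 2t ‖[H,B]‖`). This
replaces the factor `(e^{2|t|‖Φ‖} - 1)/|t|` of NS06 (3.22) near `t = 0`. [folklore] -/
theorem norm_commutator_expect_sub_le {H : Matrix n n ℂ} (hH : H.IsHermitian) (A B : Matrix n n ℂ)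
    {ψ : n → ℂ} (hψ1 : star ψ ⬝ᵥ ψ = 1) {Q : ℝ} (hQ : ‖H * B - B * H‖ ≤ Q) {t : ℝ} (ht : 0 < t) :
    ‖star ψ ⬝ᵥ ((A * heisenbergEvolution H t B - heisenbergEvolution H t B * A) *ᵥ ψ) -
        star ψ ⬝ᵥ ((A * heisenbergEvolution H (-t) B - heisenbergEvolution H (-t) B * A) *ᵥ ψ)‖ ≤
      4 * ‖A‖ * Q * t := by
  obtain ⟨W, hW⟩ : ∃ W : Matrix n n ℂ,
      heisenbergEvolution H t B - heisenbergEvolution H (-t) B = W := ⟨_, rfl⟩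
  have e1 : star ψ ⬝ᵥ ((A * heisenbergEvolution H t B - heisenbergEvolution H t B * A) *ᵥ ψ) -
      star ψ ⬝ᵥ ((A * heisenbergEvolution H (-t) B - heisenbergEvolution H (-t) B * A) *ᵥ ψ) =
      star ψ ⬝ᵥ ((A * W - W * A) *ᵥ ψ) := by
    rw [← dotProduct_sub, ← sub_mulVec, ← hW]
    congr 2
    noncomm_ring
  have e2 : ‖star ψ ⬝ᵥ ((A * W - W * A) *ᵥ ψ)‖ ≤ ‖A * W - W * A‖ :=
    norm_vectorState_le hψ1 (A * W - W * A)
  have e3 : ‖A * W - W * A‖ ≤ 2 * ‖A‖ * ‖W‖ := norm_commutator_le A W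
  have e4 : ‖W‖ ≤ ‖H * B - B * H‖ * |t - -t| :=
    hW ▸ norm_heisenbergEvolution_sub_le hH B (-t) t
  rw [sub_neg_eq_add, abs_of_pos (by linarith)] at e4
  have e5 : ‖W‖ ≤ Q * (t + t) := e4.trans (mul_le_mul_of_nonneg_right hQ (by linarith))
  rw [e1]
  calc ‖star ψ ⬝ᵥ ((A * W - W * A) *ᵥ ψ)‖ ≤ 2 * ‖A‖ * ‖W‖ := e2.trans e3
    _ ≤ 2 * ‖A‖ * (Q * (t + t)) := mul_le_mul_of_nonneg_left e5 (by positivity)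
    _ = 4 * ‖A‖ * Q * t := by ring

/-- **The trivial bound** `‖h(t)‖ ≤ 2‖A‖‖B‖` (`τ_t` is isometric). NS06 §2 ("the trivial bound
`‖[τ_t(A),B]‖ ≤ 2‖A‖‖B‖`"). [folklore] -/
theorem norm_commutator_expect_le {H : Matrix n n ℂ} (hH : H.IsHermitian) (A B : Matrix n n ℂ)
    {ψ : n → ℂ} (hψ1 : star ψ ⬝ᵥ ψ = 1) (t : ℝ) :
    ‖star ψ ⬝ᵥ ((A * heisenbergEvolution H t B - heisenbergEvolution H t B * A) *ᵥ ψ)‖ ≤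
      2 * ‖A‖ * ‖B‖ := by
  refine (norm_vectorState_le hψ1 _).trans ?_
  calc ‖A * heisenbergEvolution H t B - heisenbergEvolution H t B * A‖
      ≤ ‖A * heisenbergEvolution H t B‖ + ‖heisenbergEvolution H t B * A‖ := norm_sub_le _ _
    _ ≤ ‖A‖ * ‖heisenbergEvolution H t B‖ + ‖heisenbergEvolution H t B‖ * ‖A‖ :=
        add_le_add (norm_mul_le _ _) (norm_mul_le _ _)
    _ = 2 * ‖A‖ * ‖B‖ := by rw [norm_heisenbergEvolution_holds hH t B]; ring

/-- **The Lieb–Robinson bound for `h`**: `‖h(t)‖ ≤ c` whenever `‖[τ_t(B), A]‖ ≤ c`. [folklore] -/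
theorem norm_commutator_expect_le_of_le {H A B : Matrix n n ℂ} {ψ : n → ℂ} (hψ1 : star ψ ⬝ᵥ ψ = 1)
    {t c : ℝ} (h : ‖heisenbergEvolution H t B * A - A * heisenbergEvolution H t B‖ ≤ c) :
    ‖star ψ ⬝ᵥ ((A * heisenbergEvolution H t B - heisenbergEvolution H t B * A) *ᵥ ψ)‖ ≤ c := by
  refine (norm_vectorState_le hψ1 _).trans ?_
  rwa [norm_sub_rev]

/-- The equal-time commutator expectation vanishes for commuting observables. [folklore] -/
theorem commutator_expect_zero_of_commute {H A B : Matrix n n ℂ} (ψ : n → ℂ) (hAB : Commute A B) :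
    star ψ ⬝ᵥ ((A * heisenbergEvolution H 0 B - heisenbergEvolution H 0 B * A) *ᵥ ψ) = 0 := by
  rw [heisenbergEvolution_zero, hAB.eq, sub_self, zero_mulVec, dotProduct_zero]

end Literature.MathematicalPhysics.QuantumLattice
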